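import Mathlib
import Summits.ResolutionOfSingularities.ResolutionOfSingularities.Theorems.RadicialJungCleanModelsL1Presentation
import Literature.RingTheory.PBasis.KimuraNiitsuma1980
import Literature.RingTheory.PBasis.KimuraNiitsuma1982
import Literature.AlgebraicGeometry.Resolution.RegularLocalRingsNormal
import HarnessLib

/-!
# Lemma L1 of line `via-clean-models` (crux stmt-ResolutionOfSingularities-15917 `RadicialJung.CleanModels`):
# a REGULAR degree-`p` height-one radicial normalisation over a regular local ring is clean of type `m ≤ 1`,
# modulo the Kimura–Niitsuma 1982 relative p-basis theorem (Kunz's question; named fact F-96h)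

Line card `Cruxes/DescentPerfectToAll/Lines/via-clean-models.md` rev 2c, stub plan P0 («L1 pointwise converse»,
registrar `res-B-lens-1`, critic `res-B-crit-1` ACK 2026-08-28T17:04Z): for a regular local ring `O` of characteristic
`p` with fraction field `K`, a purely inseparable extension `L/K` of degree `p` (so `L^p ⊆ K`) whose normalisation
`B = integralClosure O L` is FINITE over `O` and a REGULAR LOCAL ring, some `y ∈ B ∖ K` has `y^p = s ∈ O` clean at the
closed point of `O`: `s ∈ 𝔪_O ∖ 𝔪_O²` (parameter type) or `s ∈ O^×` with `s - c^p ∉ 𝔪_O` for all `c ∈ O` (residually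
new unit).  This is the pointwise converse of the proved item `RadicialJung.CleanResolves` (stmt-16286) and the shape
copied from the landed dimension-one case `stub_dvrClean` (`RadicialJungCleanModelsStubDvrClean.lean`).

Also `clean_of_monogenic_regular`: the UNCONDITIONAL monogenic form (`B = O[γ] ≅ O[Y]/(Y^p - s_γ)` regular — the shape
`S[X]/(h)` of Cossart–Piltant's (S,h,E)-frame — has a clean generator), which is what the dim-3 slice plan P2(b) consumes.

## Proof (KN 1982 + bookkeeping; the algebra is in `RadicialJungCleanModelsL1Presentation.lean`)
* If some `b ∈ B` is residually NEW (`b̄ ∉ κ_O`), then `s = b^p ∈ O^×` and `s - c^p ∈ 𝔪_O` would force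
  `(b - c)^p ∈ 𝔪_O B ⊆ 𝔪_B`, i.e. `b̄ = c̄` — the unit disjunct; no input beyond `B^p ⊆ O` (height one + `O` normal).
* Otherwise `κ_B = κ_O`.  The Kimura–Niitsuma 1982 theorem (the named fact `Literature.RingTheory.PBasis.KimuraNiitsuma1982_theorem`,
  F-96h, typed 2026-08-28 p656527; it answers Kunz's question) gives a `p`-basis `Γ` of `B` over `O` (`B ⊇ O ⊇ B^p`, both regular local, `B` finite over `O`);
  `[L : K] = p` forces `Γ = {γ}` (two elements would give `p²` monomials linearly independent over `K`), so
  `B = O[γ] ≅ O[Y]/(Y^p - s_γ)`; shifting `y = γ - c ∈ 𝔪_B` (`c ∈ O`, `κ_B = κ_O`) keeps `B ≅ O[Y]/(Y^p - s)`,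
  `s = s_γ - c^p ∈ 𝔪_O`, and the cotangent count (`not_mem_sq_of_presentation`) gives `s ∉ 𝔪_O²` — the parameter
  disjunct.

Nothing here is a statement of H. Hironaka's 2017 manuscript; `RadicialJung.CleanModels` (stmt-15917) is not settled by this file in
`dim ≥ 3`; this lemma is the converse direction used by the dim-3 slice plan P2 (LU of the cover ⟹ cleanness of the
base).  CONDITIONAL on the named fact F-96h (a printed theorem, statement typed from the primary source).
-/

noncomputable section

set_option linter.dupNamespace false

open IsLocalRing Polynomial

namespace Summit.ResolutionOfSingularities.ResolutionOfSingularities.Theorems.RadicialJung.CleanModels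

/-! ## The Kimura–Niitsuma theorem in `O`-algebra form -/

section Transport

universe v w

/-- The Kimura–Niitsuma 1982 theorem (F-96h) transported from the printed SUBRING form to an injective finite algebra `O → B` of
regular local rings with `B^p ⊆ O`: `B` has a `p`-basis over `O` (generation as an `O`-algebra and `O`-linear
independence of the reduced monomials). [cite: KimuraNiitsuma1982, Theorem §3 p. 375] -/
theorem exists_pBasis_of_kimuraNiitsuma1982 (hKN : Literature.RingTheory.PBasis.KimuraNiitsuma1982_theorem.{v})
    {O : Type w} {B : Type v} [CommRing O] [IsRegularLocalRing O] [CommRing B] [IsRegularLocalRing B]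
    [Algebra O B] [Module.Finite O B] {p : ℕ} [Fact p.Prime] [CharP B p]
    (hinj : Function.Injective (algebraMap O B)) (hBp : ∀ b : B, ∃ s : O, algebraMap O B s = b ^ p) :
    ∃ Γ : Set B, Algebra.adjoin O Γ = ⊤ ∧
      ∀ (n : ℕ) (b : Fin n → B), Function.Injective b → (∀ i, b i ∈ Γ) →
        LinearIndependent O (fun e : Fin n → Fin p => ∏ i, b i ^ ((e i : ℕ))) := by
  set O' : Subring B := (algebraMap O B).range with hO'
  -- `O ≃ O'`
  let e : O ≃+* O' := RingEquiv.ofBijective (algebraMap O B).rangeRestrict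
    ⟨fun a b h => hinj (by simpa using congrArg Subtype.val h), (algebraMap O B).rangeRestrict_surjective⟩
  have he : ∀ r : O, ((e r : O') : B) = algebraMap O B r := fun r => rfl
  haveI : IsRegularLocalRing O' := IsRegularLocalRing.of_ringEquiv e
  have hfrob : (frobenius B p).range ≤ O' := by
    rintro _ ⟨b, rfl⟩
    obtain ⟨s, hs⟩ := hBp b
    exact ⟨s, by rw [hs, frobenius_def]⟩
  haveI : Module.Finite O' B := by
    obtain ⟨S, hS⟩ := Module.Finite.fg_top (R := O) (M := B)
    refine ⟨⟨S, ?_⟩⟩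
    rw [eq_top_iff]
    rintro b -
    have hb : b ∈ Submodule.span O (S : Set B) := by rw [hS]; trivial
    refine Submodule.span_induction (fun x hx => Submodule.subset_span hx) (Submodule.zero_mem _)
      (fun x y _ _ hx hy => Submodule.add_mem _ hx hy) (fun r x _ hx => ?_) hb
    rw [Algebra.smul_def, ← he, ← smul_eq_mul]
    exact Submodule.smul_mem _ (e r) hx
  obtain ⟨Γ, hadj, hli⟩ := hKN p B O' hfrob inferInstance inferInstance
  refine ⟨Γ, ?_, ?_⟩
  · rw [eq_top_iff]
    rintro b -
    have hb : b ∈ Algebra.adjoin O' Γ := by rw [hadj]; trivial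
    refine Algebra.adjoin_induction (fun x hx => Algebra.subset_adjoin hx) (fun r => ?_)
      (fun x y _ _ hx hy => Subalgebra.add_mem _ hx hy) (fun x y _ _ hx hy => Subalgebra.mul_mem _ hx hy) hb
    obtain ⟨s, hs⟩ := r.2
    have hr : algebraMap O' B r = algebraMap O B s := by rw [hs]; rfl
    rw [hr]
    exact Subalgebra.algebraMap_mem _ s
  · intro n b hb hΓ
    have h := (hli n b hb hΓ).map_of_injective_injective (e : O → O') (AddMonoidHom.id B)
      (fun r hr => e.injective (by rw [hr, map_zero])) (fun m hm => hm)
      (fun r m => by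
        change ((e r : O') : B) * m = r • m
        rw [he, Algebra.smul_def])
    exact h

end Transport


/-! ## The monogenic case (unconditional): `B = O[γ] ≅ O[Y]/(Y^p - s_γ)` regular ⟹ a clean generator -/

section Monogenic

universe v w

/-- **L1, monogenic form (no named fact needed).**  Let `O ⊆ B` be regular local rings of characteristic `p`, `B`
finite over `O` along a local homomorphism, and suppose `B = O[γ]` with `γ^p = s_γ ∈ O` and `1, γ, …, γ^{p-1}`
linearly independent over `O` (i.e. `B ≅ O[Y]/(Y^p - s_γ)` — the shape `S[X]/(h)`, `h = X^p + f`, of Cossart–Piltant's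
frame).  Then `B = O[y]` for some `y` with `y^p = s ∈ O` CLEAN: `s ∈ 𝔪_O ∖ 𝔪_O²`, or `s` a unit with `s - c^p ∉ 𝔪_O`
for all `c ∈ O`.  (If `γ̄ ∉ κ_O` take `y = γ`; otherwise `γ̄ = c̄`, take `y = γ - c` and apply the cotangent count
`not_mem_sq_of_presentation`.)  This is the form consumed by the dim-3 slice plan P2(b) (the strict transform
`S_r[X]/(h_r)` of the LU sequence is monogenic by construction). [folklore] -/
theorem clean_of_monogenic_regular {O : Type w} {B : Type v} [CommRing O] [IsRegularLocalRing O] [CommRing B]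
    [IsRegularLocalRing B] [Algebra O B] [Module.Finite O B] [IsLocalHom (algebraMap O B)]
    (p : ℕ) (hp : p.Prime) [CharP B p] (hinj : Function.Injective (algebraMap O B))
    (γ : B) (sγ : O) (hγ : algebraMap O B sγ = γ ^ p) (hadj : Algebra.adjoin O {γ} = ⊤)
    (hli : LinearIndependent O (fun i : Fin p => γ ^ (i : ℕ))) :
    ∃ (y : B) (s : O), Algebra.adjoin O {y} = ⊤ ∧ algebraMap O B s = y ^ p ∧
      ((s ∈ maximalIdeal O ∧ s ∉ maximalIdeal O ^ 2) ∨
        (IsUnit s ∧ ∀ c : O, s - c ^ p ∉ maximalIdeal O)) := by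
  haveI : Fact p.Prime := ⟨hp⟩
  haveI : CharP O p := (algebraMap O B).charP hinj p
  have hmO : ∀ a : O, a ∈ maximalIdeal O ↔ algebraMap O B a ∈ maximalIdeal B := by
    intro a
    rw [IsLocalRing.mem_maximalIdeal, IsLocalRing.mem_maximalIdeal]
    exact (map_mem_nonunits_iff (algebraMap O B) a).symm
  by_cases hA : ∀ c : O, γ - algebraMap O B c ∉ maximalIdeal B
  · -- residually new generator: `s_γ` is a residually non-`p`-th-power unit
    have hγu : IsUnit γ := by
      by_contra h
      exact hA 0 (by rw [map_zero, sub_zero]; exact h)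
    have hsu : IsUnit sγ := by
      rw [← isUnit_map_iff (algebraMap O B) sγ, hγ]
      exact hγu.pow p
    refine ⟨γ, sγ, hadj, hγ, Or.inr ⟨hsu, fun c hc => hA c ?_⟩⟩
    have hpow : (γ - algebraMap O B c) ^ p ∈ maximalIdeal B := by
      rw [sub_pow_char, ← hγ, ← map_pow, ← map_sub]
      exact (hmO _).mp hc
    exact (IsLocalRing.maximalIdeal.isMaximal B).isPrime.mem_of_pow_mem p hpow
  · -- `γ̄ = c̄`: shift into `𝔪_B` and count cotangent vectors
    push Not at hA
    obtain ⟨c, hc⟩ := hA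
    set y : B := γ - algebraMap O B c with hydef
    set s : O := sγ - c ^ p with hsdef
    have hys : algebraMap O B s = y ^ p := by
      rw [hsdef, hydef, map_sub, map_pow, hγ, sub_pow_char]
    obtain ⟨hsurjγ, hkerγ⟩ :=
      aeval_surjective_and_ker_eq_of_linearIndependent_pow hp.pos γ sγ hγ hadj hli
    obtain ⟨hsurj, hker⟩ := presentation_shift γ sγ hsurjγ hkerγ c
    have hadj' : Algebra.adjoin O {y} = ⊤ := by
      rw [Algebra.adjoin_singleton_eq_range_aeval, AlgHom.range_eq_top]
      exact hsurj
    have hsm : s ∈ maximalIdeal O := by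
      rw [hmO, hys]
      exact Ideal.pow_mem_of_mem _ hc p hp.pos
    have hs2 : s ∉ maximalIdeal O ^ 2 := not_mem_sq_of_presentation hinj hp y s hc hsurj hker
    exact ⟨y, s, hadj', hys, Or.inl ⟨hsm, hs2⟩⟩

end Monogenic

/-! ## Lemma L1 -/

section Main

universe v w w'

/-- **Lemma L1 (pointwise converse of `CleanResolves`), modulo the Kimura–Niitsuma 1982 theorem (F-96h).**  Let `O` be a regular
local ring of characteristic `p` with fraction field `K`, `L/K` a field extension with `L^p ⊆ K`, `L ≠ K` and
`[L : K] = p`, and suppose the normalisation `B = integralClosure O L` is finite over `O` and a regular local ring.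
Then some `y ∈ B ∖ K` has `y^p = s ∈ O` CLEAN: either `s ∈ 𝔪_O ∖ 𝔪_O²` (parameter type), or `s` is a unit with
`s - c^p ∉ 𝔪_O` for every `c ∈ O` (residually new unit).  The residually-new case needs only `B^p ⊆ O`; the case
`κ_B = κ_O` uses Kimura–Niitsuma's theorem (`B` has a `p`-basis over `O`, necessarily a single `γ`, and the cotangent
count `not_mem_sq_of_presentation`). [cite: KimuraNiitsuma1982, Theorem §3 p. 375] -/
theorem clean_of_regular_radicial_normalization_of_kimuraNiitsuma1982
    {O : Type w} {K : Type w'} {L : Type v} (hKN : Literature.RingTheory.PBasis.KimuraNiitsuma1982_theorem.{v})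
    [CommRing O] [IsDomain O] [IsRegularLocalRing O]
    [Field K] [Algebra O K] [IsFractionRing O K] [Field L] [Algebra K L] [Algebra O L]
    [IsScalarTower O K L] (p : ℕ) (hp : p.Prime) [CharP L p]
    (hLp : ∀ y : L, ∃ x : K, algebraMap K L x = y ^ p)
    (hKL : ∃ y₀ : L, y₀ ∉ Set.range (algebraMap K L))
    (hdeg : Module.finrank K L = p)
    (hfin : Module.Finite O (integralClosure O L))
    (hB : IsRegularLocalRing (integralClosure O L)) :
    ∃ (y : L) (s : O), y ∉ Set.range (algebraMap K L) ∧ algebraMap O L s = y ^ p ∧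
      ((s ∈ maximalIdeal O ∧ s ∉ maximalIdeal O ^ 2) ∨
        (IsUnit s ∧ ∀ c : O, s - c ^ p ∉ maximalIdeal O)) := by
  classical
  haveI : Fact p.Prime := ⟨hp⟩
  haveI := hB
  haveI := hfin
  set B := integralClosure O L with hBdef
  -- injectivity of the structure maps, characteristic, normality of `O`
  have hinjOL : Function.Injective (algebraMap O L) := by
    rw [IsScalarTower.algebraMap_eq O K L, RingHom.coe_comp]
    exact (algebraMap K L).injective.comp (IsFractionRing.injective O K)
  have hinjOB : Function.Injective (algebraMap O B) := by
    have h := hinjOL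
    rw [IsScalarTower.algebraMap_eq O B L, RingHom.coe_comp] at h
    exact Function.Injective.of_comp h
  haveI : FaithfulSMul O B := (faithfulSMul_iff_algebraMap_injective O B).mpr hinjOB
  haveI : CharP B p := (algebraMap B L).charP Subtype.val_injective p
  haveI : CharP O p := (algebraMap O L).charP hinjOL p
  haveI : IsIntegrallyClosed O :=
    Literature.AlgebraicGeometry.Resolution.isIntegrallyClosed_of_isRegularLocalRing O
  -- `L` is algebraic over `K`, hence over `O`
  have hintKL : Algebra.IsIntegral K L := ⟨fun y => by
    obtain ⟨x, hx⟩ := hLp y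
    exact IsIntegral.of_pow hp.pos (hx ▸ isIntegral_algebraMap)⟩
  haveI : Algebra.IsAlgebraic O L :=
    (IsFractionRing.comap_isAlgebraic_iff (A := O) (K := K) (C := L)).mpr inferInstance
  haveI : Module.Finite K L := Module.finite_of_finrank_pos (by rw [hdeg]; exact hp.pos)
  -- `B^p ⊆ O`
  have hBpL : ∀ b : B, ∃ s : O, algebraMap O L s = (b : L) ^ p := by
    intro b
    obtain ⟨x, hx⟩ := hLp b
    have hxint : IsIntegral O x := by
      rw [← isIntegral_algebraMap_iff (B := L) (algebraMap K L).injective, hx]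
      exact b.2.pow p
    obtain ⟨s, hs⟩ := IsIntegrallyClosed.algebraMap_eq_of_integral hxint
    exact ⟨s, by rw [IsScalarTower.algebraMap_apply O K L, hs, hx]⟩
  have toB : ∀ (b : B) (s : O), algebraMap O L s = (b : L) ^ p → algebraMap O B s = b ^ p := by
    intro b s hs
    apply Subtype.val_injective
    simp only [SubmonoidClass.coe_pow]
    rw [← hs, Subalgebra.coe_algebraMap]
  have hBp : ∀ b : B, ∃ s : O, algebraMap O B s = b ^ p := fun b => by
    obtain ⟨s, hs⟩ := hBpL b
    exact ⟨s, toB b s hs⟩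
  -- the structure map is local: units are detected by `p`-th powers
  haveI : IsLocalHom (algebraMap O B) := by
    constructor
    intro s hsu
    obtain ⟨u, hu⟩ := hsu
    obtain ⟨t, ht⟩ := hBp (↑u⁻¹ : B)
    have h1 : algebraMap O B (s ^ p * t) = 1 := by
      rw [map_mul, map_pow, ht, ← mul_pow, ← hu, Units.mul_inv, one_pow]
    have h2 : s ^ p * t = 1 := hinjOB (by rw [h1, map_one])
    exact (isUnit_pow_iff hp.ne_zero).mp (IsUnit.of_mul_eq_one _ h2)
  have hmO : ∀ a : O, a ∈ maximalIdeal O ↔ algebraMap O B a ∈ maximalIdeal B := by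
    intro a
    rw [IsLocalRing.mem_maximalIdeal, IsLocalRing.mem_maximalIdeal]
    exact (map_mem_nonunits_iff (algebraMap O B) a).symm
  -- an element of `B` whose `p`-th power `s ∈ O` is not a `p`-th power in `O` is not in `K`
  have notK : ∀ (y : B) (s : O), algebraMap O L s = (y : L) ^ p → (∀ x : O, s ≠ x ^ p) →
      (y : L) ∉ Set.range (algebraMap K L) := by
    rintro y s hys hsx ⟨x, hx⟩
    have hxint : IsIntegral O x := by
      rw [← isIntegral_algebraMap_iff (B := L) (algebraMap K L).injective, hx]
      exact y.2
    obtain ⟨x', hx'⟩ := IsIntegrallyClosed.algebraMap_eq_of_integral hxint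
    refine hsx x' (hinjOL ?_)
    rw [hys, ← hx, ← hx', map_pow, ← IsScalarTower.algebraMap_apply]
  -- it suffices to produce `y ∈ B` and a clean `s ∈ O` with `s = y ^ p`
  suffices h : ∃ (y : B) (s : O), algebraMap O L s = (y : L) ^ p ∧
      ((s ∈ maximalIdeal O ∧ s ∉ maximalIdeal O ^ 2) ∨
        (IsUnit s ∧ ∀ c : O, s - c ^ p ∉ maximalIdeal O)) by
    obtain ⟨y, s, hys, hclean⟩ := h
    refine ⟨y, s, notK y s hys ?_, hys, hclean⟩
    rintro x rfl
    rcases hclean with ⟨h1, h2⟩ | ⟨-, h2⟩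
    · exact h2 (Ideal.pow_le_pow_right hp.two_le (Ideal.pow_mem_pow
        ((IsLocalRing.maximalIdeal.isMaximal O).isPrime.mem_of_pow_mem p h1) p))
    · exact h2 x (by rw [sub_self]; exact Submodule.zero_mem _)
  have toL : ∀ (b : B) (s : O), algebraMap O B s = b ^ p → algebraMap O L s = (b : L) ^ p := by
    intro b s hs
    rw [IsScalarTower.algebraMap_apply O B L, hs]
    rfl
  by_cases hA : ∃ b : B, ∀ c : O, b - algebraMap O B c ∉ maximalIdeal B
  · /- CASE A: a residually new element `b` (its residue is not in `κ_O`): `s = b^p` is a residually new unit. -/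
    obtain ⟨b, hb⟩ := hA
    obtain ⟨s, hs⟩ := hBp b
    have hbu : IsUnit b := by
      by_contra h
      exact hb 0 (by rw [map_zero, sub_zero]; exact h)
    have hsu : IsUnit s := by
      rw [← isUnit_map_iff (algebraMap O B) s, hs]
      exact hbu.pow p
    refine ⟨b, s, toL b s hs, Or.inr ⟨hsu, fun c hc => hb c ?_⟩⟩
    have hpow : (b - algebraMap O B c) ^ p ∈ maximalIdeal B := by
      rw [sub_pow_char, ← hs, ← map_pow, ← map_sub]
      exact (hmO _).mp hc
    exact (IsLocalRing.maximalIdeal.isMaximal B).isPrime.mem_of_pow_mem p hpow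
  · /- CASE B: `κ_B = κ_O`.  Kimura–Niitsuma's theorem gives a `p`-basis `Γ = {γ}` of `B` over `O`; shift `γ` into `𝔪_B`
    and count cotangent vectors. -/
    push Not at hA
    obtain ⟨Γ, hadj, hli⟩ := exists_pBasis_of_kimuraNiitsuma1982 hKN hinjOB hBp
    -- some element of `B` is not in `O` (from `L ≠ K`)
    obtain ⟨b₀, hb₀⟩ : ∃ b : B, b ∉ Set.range (algebraMap O B) := by
      obtain ⟨y₀, hy₀⟩ := hKL
      obtain ⟨d, hd, hint⟩ :=
        (Algebra.IsAlgebraic.isAlgebraic (R := O) y₀).exists_integral_multiple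
      refine ⟨⟨d • y₀, hint⟩, ?_⟩
      rintro ⟨z, hz⟩
      apply hy₀
      have hd' : algebraMap O L d ≠ 0 := (map_ne_zero_iff _ hinjOL).mpr hd
      refine ⟨(algebraMap O K d)⁻¹ * algebraMap O K z, ?_⟩
      have hz' : algebraMap O L z = d • y₀ := by
        rw [IsScalarTower.algebraMap_apply O B L, hz]
        rfl
      rw [map_mul, map_inv₀, ← IsScalarTower.algebraMap_apply, ← IsScalarTower.algebraMap_apply, hz',
        Algebra.smul_def, ← mul_assoc, inv_mul_cancel₀ hd', one_mul]
    -- `Γ` is non-empty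
    obtain ⟨γ, hγ⟩ : Γ.Nonempty := by
      rw [Set.nonempty_iff_ne_empty]
      rintro rfl
      rw [Algebra.adjoin_empty] at hadj
      have : b₀ ∈ (⊥ : Subalgebra O B) := by rw [hadj]; trivial
      exact hb₀ (Algebra.mem_bot.mp this)
    -- `Γ = {γ}`: two distinct elements would give `p²` monomials linearly independent over `K` in `L`
    have hΓ : Γ = {γ} := by
      refine Set.eq_singleton_iff_unique_mem.mpr ⟨hγ, fun γ' hγ' => ?_⟩
      by_contra hne
      have hbinj : Function.Injective ![γ, γ'] := by
        intro i j hij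
        fin_cases i <;> fin_cases j
        · rfl
        · exact absurd hij.symm hne
        · exact absurd hij hne
        · rfl
      have hmem : ∀ i, ![γ, γ'] i ∈ Γ := by
        intro i; fin_cases i
        · exact hγ
        · exact hγ'
      have h2 := hli 2 ![γ, γ'] hbinj hmem
      -- push to `L`, then to `K`-linear independence
      have h2L : LinearIndependent O
          (fun e : Fin 2 → Fin p => ((∏ i, ![γ, γ'] i ^ ((e i : ℕ)) : B) : L)) := by
        have := h2.map' (IsScalarTower.toAlgHom O B L).toLinearMap
          (LinearMap.ker_eq_bot.mpr Subtype.val_injective)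
        exact this
      rw [LinearIndependent.iff_fractionRing O K] at h2L
      have hcard := h2L.fintype_card_le_finrank
      rw [Fintype.card_fun, Fintype.card_fin, Fintype.card_fin, hdeg] at hcard
      have : p * p ≤ p * 1 := by simpa [pow_two] using hcard
      have := Nat.le_of_mul_le_mul_left this hp.pos
      exact absurd this (not_le.mpr hp.one_lt)
    rw [hΓ] at hadj
    -- linear independence of `1, γ, …, γ^{p-1}`
    have hliγ : LinearIndependent O (fun i : Fin p => γ ^ (i : ℕ)) := by
      have h1 := hli 1 ![γ] (Function.injective_of_subsingleton _) (fun i => by fin_cases i; exact hγ)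
      have h1' := h1.comp (fun i : Fin p => (fun _ : Fin 1 => i))
        (fun i j hij => by simpa using congrFun hij 0)
      have hfun : ((fun e : Fin 1 → Fin p => ∏ i, ![γ] i ^ ((e i : ℕ))) ∘ fun i : Fin p => fun _ : Fin 1 => i) =
          fun i : Fin p => γ ^ (i : ℕ) := by
        ext i
        simp
      rw [hfun] at h1'
      exact h1'
    -- shift `γ` into `𝔪_B`
    obtain ⟨c, hc⟩ := hA γ
    set y : B := γ - algebraMap O B c with hydef
    have hy : y ∈ maximalIdeal B := hc
    obtain ⟨sγ, hsγ⟩ := hBp γ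
    set s : O := sγ - c ^ p with hsdef
    have hys : algebraMap O B s = y ^ p := by
      rw [hsdef, hydef, map_sub, map_pow, hsγ, sub_pow_char]
    -- `B = O[y] ≅ O[Y]/(Y^p - s)`
    obtain ⟨hsurjγ, hkerγ⟩ :=
      aeval_surjective_and_ker_eq_of_linearIndependent_pow hp.pos γ sγ hsγ hadj hliγ
    obtain ⟨hsurj, hker⟩ := presentation_shift γ sγ hsurjγ hkerγ c
    have hsm : s ∈ maximalIdeal O := by
      rw [hmO, hys]
      exact Ideal.pow_mem_of_mem _ hy p hp.pos
    have hs2 : s ∉ maximalIdeal O ^ 2 := not_mem_sq_of_presentation hinjOB hp y s hy hsurj hker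
    exact ⟨y, s, toL y s hys, Or.inl ⟨hsm, hs2⟩⟩

end Main

end Summit.ResolutionOfSingularities.ResolutionOfSingularities.Theorems.RadicialJung.CleanModels

end
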